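import Mathlib
import HarnessLib
import Summits.HubbardSuperconductivity.HubbardSuperconductivity.Theorems.WeakCouplingBCSKlCertTPrimeBottomStates

/-!
# «(KLSCAN)-TPRIME-SOUNDNESS» (3/5): certified bounds for one channel bottom, generic

Cell `gate-hubbard-kl`, seat p3 (g20); located item «(KLSCAN)-TPRIME-SOUNDNESS» (pen (R269)(D)/(R279); director INBOX l.284 KL-MARGIN-SCAN (α)).
HYPOTHESIS STYLE: the t′ = 0 soundness chain behind `klb1gd_window(_U)` (`…ChannelOps` → `…BottomStates` → `…ChannelBound` → `…ChannelFar` →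
`…BlockBounds` → `…KlCertFormD`) re-keyed VERBATIM at an arbitrary dispersion `ε` / at `squareDispersion 1 tp`, with the five analytic leaves
(finite Fermi-curve measure, `D₄` measure preservation, Hilbert–Schmidt Lindhard kernel, `D₄`-invariance of `χ₀`, channel-state existence) carried
as ONE hypothesis `KLTPAnalytic ε μ` instead of the registered `stub_kl*` leaves (which prove them at `t′ = 0`, `μ ∈ (−4,0)`: `klTPAnalytic_zero`).
Nothing here asserts a certificate at any `t′ ≠ 0`, the margin, the window or superconductivity.  `--supports stmt-HubbardSuperconductivity-0158` (helper).
References: M. Reed, B. Simon, *Methods of Modern Mathematical Physics* I Thm. VI.16/VI.23, IV Thm. XIII.5; S. Raghu, S. A. Kivelson, D. J. Scalapino,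
Phys. Rev. B 81 (2010) 224505, §II–§III.
This file: `kltp_cb_pairingForm_ge`, `kltp_cb_setup`, `kltp_channelBound` (twins of `…ChannelBound`), `kltp_channelFar` (twin of `…ChannelFar`).
-/

noncomputable section

set_option linter.dupNamespace false

namespace Summit.HubbardSuperconductivity.HubbardSuperconductivity.Theorems

open MeasureTheory Literature.MathematicalPhysics.QuantumLattice Literature.Analysis.OperatorTheory CwKLChiralWindow
open Summit.HubbardSuperconductivity.HubbardSuperconductivity.Theorems.CwKLChiralWindow.Negative
open scoped InnerProductSpace Pointwise

/-! ## ChannelBound, generic -/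

/-- **Pairing form versus the base-kernel form.** For `μ ∈ (-4,0)`, a channel-`χ` state `ψ` and the base kernel
`κ = [withU] + χ₀` with `withU → χ = A1g`: `∫ ψ (∫ κ ψ) ≤ pairingForm ε₀ μ 1 ψ`, with equality when `withU` or
`χ ≠ A1g` (splitting of the form; vanishing mean off `A1g`). [folklore] -/
theorem kltp_cb_pairingForm_ge {ε : Momentum → ℝ} {μ : ℝ} (hμ : KLTPAnalytic ε μ) {χ : D4Irrep} {withU : Bool}
    (hU : withU = true → χ = D4Irrep.A1g) {ψ : Momentum → ℝ} (hψ : IsChannelState ε μ χ ψ) :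
    ∫ k, ψ k * ∫ k', ((if withU then 1 else 0) + lindhardFunction ε μ (k + k')) * ψ k'
        ∂fermiCurveMeasure ε μ ∂fermiCurveMeasure ε μ ≤
      pairingForm ε μ 1 ψ ∧
    ((withU = true ∨ χ ≠ D4Irrep.A1g) →
      pairingForm ε μ 1 ψ =
        ∫ k, ψ k * ∫ k', ((if withU then 1 else 0) + lindhardFunction ε μ (k + k')) * ψ k'
          ∂fermiCurveMeasure ε μ ∂fermiCurveMeasure ε μ) := by
  haveI : IsFiniteMeasure (fermiCurveMeasure ε μ) := hμ.1
  have hsplit := klhs_frame_pairingForm_split 1 hμ.2.2.1 hψ.1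
  cases withU with
  | true =>
    have heq : pairingForm ε μ 1 ψ =
        ∫ k, ψ k * ∫ k', ((if true then 1 else 0) + lindhardFunction ε μ (k + k')) * ψ k'
          ∂fermiCurveMeasure ε μ ∂fermiCurveMeasure ε μ := by
      simp only [pairingForm, kl_cb_kernel_one, ↓reduceIte]
    exact ⟨heq.ge, fun _ => heq⟩
  | false =>
    have heq0 : ∫ k, ψ k * ∫ k', ((if false then 1 else 0) + lindhardFunction ε μ (k + k')) * ψ k'
          ∂fermiCurveMeasure ε μ ∂fermiCurveMeasure ε μ =
        ∫ k, ψ k * ∫ k', lindhardFunction ε μ (k + k') * ψ k'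
          ∂fermiCurveMeasure ε μ ∂fermiCurveMeasure ε μ := by
      simp only [Bool.false_eq_true, ↓reduceIte, zero_add]
    rw [heq0, hsplit, one_mul, one_pow, one_mul]
    refine ⟨by nlinarith [sq_nonneg (∫ k, ψ k ∂fermiCurveMeasure ε μ)], ?_⟩
    rintro (h | hχ)
    · exact absurd h (by decide)
    · have hmean := (stub_klMeanZero ε μ ‹_› hμ.2.1 χ ψ hχ hψ).2
      rw [hmean]; ring

/-! ### The setup: compression, trial vector, Temple -/

set_option maxHeartbeats 800000 in
/-- **The certified channel package.** Operators `A, P, U₁` of `…ChannelOps`, the compression `T` of `A` to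
`V = ker (1 - P)`, the normalised trial vector `x = Φ/√N ∈ V`, and the bottom eigenvalue `l` of `T` with the conclusions
of `temple_certificate` (Ritz `l ≤ ρhi`, Temple `min f ≤ l`, Rayleigh `≥ l`, gap `β`, Kato enclosure of `x`, multiplicity
mass). [folklore] -/
theorem kltp_cb_setup {ε : Momentum → ℝ} {μ : ℝ} (hμ : KLTPAnalytic ε μ) (χ : D4Irrep) (withU : Bool)
    (hU : withU = true → χ = D4Irrep.A1g) {M : ℕ} {c : Fin M → ℝ} {u : Fin M → Momentum → ℝ}
    (hu : ∀ m, MemLp (u m) 2 (fermiCurveMeasure ε μ)) (hc : ∀ m, 0 ≤ c m)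
    {Φ : Momentum → ℝ} (hΦ : MemLp Φ 2 (fermiCurveMeasure ε μ)) (hΦch : InChannel χ Φ)
    {ρlo ρhi α h β : ℝ}
    (hN : 0 < ∫ k, Φ k ^ 2 ∂fermiCurveMeasure ε μ)
    (hρlo : ρlo * ∫ k, Φ k ^ 2 ∂fermiCurveMeasure ε μ ≤
      ∫ k, Φ k * ∫ k', ((if withU then 1 else 0) + lindhardFunction ε μ (k + k')) * Φ k'
        ∂fermiCurveMeasure ε μ ∂fermiCurveMeasure ε μ)
    (hρhi : ∫ k, Φ k * ∫ k', ((if withU then 1 else 0) + lindhardFunction ε μ (k + k')) * Φ k'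
        ∂fermiCurveMeasure ε μ ∂fermiCurveMeasure ε μ ≤
      ρhi * ∫ k, Φ k ^ 2 ∂fermiCurveMeasure ε μ)
    (hρhi0 : ρhi < 0)
    (hα : ∫ k, (∫ k', ((if withU then 1 else 0) + lindhardFunction ε μ (k + k')) * Φ k'
        ∂fermiCurveMeasure ε μ) ^ 2 ∂fermiCurveMeasure ε μ ≤
      α * ∫ k, Φ k ^ 2 ∂fermiCurveMeasure ε μ)
    (hH : ∫ z, (d4Project χ (fun q => (if withU then 1 else 0) + lindhardFunction ε μ (z.1 + q)) z.2 -
        ∑ m, c m * (u m z.1 * u m z.2)) ^ 2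
        ∂(fermiCurveMeasure ε μ).prod (fermiCurveMeasure ε μ) ≤ h)
    (hβ0 : β ≤ 0) (hβ : h - (if χ = D4Irrep.E then 2 else 1) * ρhi ^ 2 ≤ β ^ 2) (hρβ : ρhi < β) :
    ∃ (A P U₁ : Lp ℝ 2 (fermiCurveMeasure ε μ) →L[ℝ] Lp ℝ 2 (fermiCurveMeasure ε μ))
      (V : Submodule ℝ (Lp ℝ 2 (fermiCurveMeasure ε μ))) (T : V →L[ℝ] V) (x : V) (l : ℝ),
      -- the sector
      (∀ v, v ∈ V ↔ P v = v) ∧ CompleteSpace V ∧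
      -- the operators
      (∀ φ : Lp ℝ 2 (fermiCurveMeasure ε μ),
        (A φ : Momentum → ℝ) =ᵐ[fermiCurveMeasure ε μ]
          fun k => ∫ k', ((if withU then 1 else 0) + lindhardFunction ε μ (k + k')) * φ k'
            ∂fermiCurveMeasure ε μ) ∧
      (∀ φ ψ : Lp ℝ 2 (fermiCurveMeasure ε μ),
        inner ℝ ψ (A φ) = ∫ k, ψ k * ∫ k', ((if withU then 1 else 0) +
            lindhardFunction ε μ (k + k')) * φ k'
          ∂fermiCurveMeasure ε μ ∂fermiCurveMeasure ε μ) ∧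
      IsSelfAdjoint A ∧ IsCompactOperator A ∧ A * P = P * A ∧
      (∀ (ψ : Momentum → ℝ) (hψ : MemLp ψ 2 (fermiCurveMeasure ε μ)),
        InChannel χ ψ → P (hψ.toLp ψ) = hψ.toLp ψ) ∧
      (∀ φ : Lp ℝ 2 (fermiCurveMeasure ε μ), P φ = φ →
        ∃ ψ : Momentum → ℝ, InChannel χ ψ ∧ MemLp ψ 2 (fermiCurveMeasure ε μ) ∧
          (φ : Momentum → ℝ) =ᵐ[fermiCurveMeasure ε μ] ψ) ∧
      (∀ φ : Lp ℝ 2 (fermiCurveMeasure ε μ),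
        (U₁ φ : Momentum → ℝ) =ᵐ[fermiCurveMeasure ε μ] fun k => φ (rotMomentum k)) ∧
      A * U₁ = U₁ * A ∧ P * U₁ = U₁ * P ∧
      (∀ φ ψ : Lp ℝ 2 (fermiCurveMeasure ε μ), inner ℝ (U₁ φ) (U₁ ψ) = inner ℝ φ ψ) ∧
      (χ = D4Irrep.E → ∀ v : Lp ℝ 2 (fermiCurveMeasure ε μ), P v = v → inner ℝ v (U₁ v) = 0) ∧
      -- the compression and the trial vector
      (∀ v, (T v : Lp ℝ 2 (fermiCurveMeasure ε μ)) = A v) ∧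
      ‖x‖ = 1 ∧
      (x : Lp ℝ 2 (fermiCurveMeasure ε μ)) =
        (Real.sqrt (∫ k, Φ k ^ 2 ∂fermiCurveMeasure ε μ))⁻¹ • hΦ.toLp Φ ∧
      -- the bottom eigenvalue and the Temple / Kato / multiplicity conclusions
      (∃ v, v ≠ 0 ∧ T v = l • v) ∧ l ≤ ρhi ∧
      min ((β * ρlo - α) / (β - ρlo)) ((β * ρhi - α) / (β - ρhi)) ≤ l ∧
      (∀ y, l * ‖y‖ ^ 2 ≤ inner ℝ y (T y)) ∧
      (∀ (c' : ℝ) (v), v ≠ 0 → T v = c' • v → c' = l ∨ β ≤ c') ∧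
      (∃ v, T v = l • v ∧ ‖x - v‖ ^ 2 ≤ (α - ρhi ^ 2) / (β - ρhi) ^ 2) ∧
      (∀ (m : ℕ) (w : Fin m → V), Orthonormal ℝ w → (∀ j, T (w j) = l • w j) → (m : ℝ) * ρhi ^ 2 ≤ h) := by
  haveI : IsFiniteMeasure (fermiCurveMeasure ε μ) := hμ.1
  obtain ⟨A, P, U₁, hA, hAinner, hAsa, hAc, hAP, hPP, hPsa, hPae, hPfix, hPrepr, hU₁ae, hAU, hPU, hUinner, hEskew,
    hHS, hBpos⟩ := @kltp_channelOps ε μ hμ.1 hμ.2.1 hμ.2.2.1 hμ.2.2.2.1 χ withU M c u hu hU hc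
  -- the sector and the compression
  obtain ⟨V, hmemV, hVc⟩ : ∃ V : Submodule ℝ (Lp ℝ 2 (fermiCurveMeasure ε μ)),
      (∀ v, v ∈ V ↔ P v = v) ∧ CompleteSpace V :=
    ⟨_, fun v => kl_cb_mem_ker_iff P v, (ContinuousLinearMap.isClosed_ker _).completeSpace_coe⟩
  haveI : CompleteSpace V := hVc
  have hVA : ∀ v ∈ V, A v ∈ V := by
    intro v hv
    rw [hmemV] at hv ⊢
    have h1 := congrArg (fun f => f v) hAP
    simp only [mul_apply_eq_comp] at h1
    rw [hv] at h1
    exact h1.symm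
  obtain ⟨T, hT, hTsa', hTc'⟩ := exists_compression A V hVA
  have hTsa := hTsa' hAsa
  have hTc := hTc' hAc
  -- the trial vector
  have hx₀ae : (hΦ.toLp Φ : Momentum → ℝ) =ᵐ[fermiCurveMeasure ε μ] Φ := hΦ.coeFn_toLp
  have hx₀V : hΦ.toLp Φ ∈ V := (hmemV _).2 (hPfix Φ hΦ hΦch)
  have hx₀norm : ‖hΦ.toLp Φ‖ ^ 2 = ∫ k, Φ k ^ 2 ∂fermiCurveMeasure ε μ :=
    kl_bs_norm_sq_eq_integral_of_ae_eq hx₀ae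
  have hsqrtN : 0 < Real.sqrt (∫ k, Φ k ^ 2 ∂fermiCurveMeasure ε μ) := Real.sqrt_pos.2 hN
  have hxHnorm : ‖(Real.sqrt (∫ k, Φ k ^ 2 ∂fermiCurveMeasure ε μ))⁻¹ • hΦ.toLp Φ‖ = 1 := by
    rw [norm_smul, Real.norm_eq_abs, abs_of_pos (inv_pos.2 hsqrtN)]
    have : ‖hΦ.toLp Φ‖ = Real.sqrt (∫ k, Φ k ^ 2 ∂fermiCurveMeasure ε μ) := by
      rw [← Real.sqrt_sq (norm_nonneg (hΦ.toLp Φ)), hx₀norm]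
    rw [this, inv_mul_cancel₀ hsqrtN.ne']
  obtain ⟨x, hxnorm, hxdef⟩ : ∃ x : V, ‖x‖ = 1 ∧ (x : Lp ℝ 2 (fermiCurveMeasure ε μ)) =
      (Real.sqrt (∫ k, Φ k ^ 2 ∂fermiCurveMeasure ε μ))⁻¹ • hΦ.toLp Φ :=
    ⟨⟨_, V.smul_mem _ hx₀V⟩, hxHnorm, rfl⟩
  -- Rayleigh quotient and image norm of the trial vector
  have hinner₀ : inner ℝ (hΦ.toLp Φ) (A (hΦ.toLp Φ)) = ∫ k, Φ k * ∫ k', ((if withU then 1 else 0) +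
      lindhardFunction ε μ (k + k')) * Φ k'
        ∂fermiCurveMeasure ε μ ∂fermiCurveMeasure ε μ :=
    kl_bs_inner_eq_of_ae_eq (fun q => (if withU then 1 else 0) + lindhardFunction ε μ q) A
      hAinner hx₀ae
  have hρ : inner ℝ x (T x) = (∫ k, Φ k ^ 2 ∂fermiCurveMeasure ε μ)⁻¹ *
      inner ℝ (hΦ.toLp Φ) (A (hΦ.toLp Φ)) := by
    rw [(compression_inner_norm hT x).1, hxdef, map_smul, real_inner_smul_left, real_inner_smul_right, ← mul_assoc,
      ← mul_inv, Real.mul_self_sqrt hN.le]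
  have hρlo' : ρlo ≤ inner ℝ x (T x) := by
    rw [hρ, hinner₀, le_inv_mul_iff₀ hN]; linarith
  have hρhi' : inner ℝ x (T x) ≤ ρhi := by
    rw [hρ, hinner₀, inv_mul_le_iff₀ hN]; linarith
  have hAx₀ae : (A (hΦ.toLp Φ) : Momentum → ℝ) =ᵐ[fermiCurveMeasure ε μ] fun k =>
      ∫ k', ((if withU then 1 else 0) + lindhardFunction ε μ (k + k')) * Φ k'
        ∂fermiCurveMeasure ε μ := by
    filter_upwards [hA (hΦ.toLp Φ)] with k hk
    rw [hk]
    exact kl_bs_kernelIntegral_congr (fun q => (if withU then 1 else 0) + lindhardFunction ε μ q)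
      hx₀ae k
  have hTx : ‖T x‖ ^ 2 ≤ α := by
    rw [(compression_inner_norm hT x).2, hxdef, map_smul, norm_smul, mul_pow, Real.norm_eq_abs,
      abs_of_pos (inv_pos.2 hsqrtN), inv_pow, Real.sq_sqrt hN.le, kl_bs_norm_sq_eq_integral_of_ae_eq hAx₀ae,
      inv_mul_le_iff₀ hN]
    linarith
  -- multiplicity
  obtain ⟨d, hd, hdcast, hdE, hdnE⟩ : ∃ d : ℕ, 1 ≤ d ∧ (d : ℝ) = (if χ = D4Irrep.E then 2 else 1 : ℝ) ∧
      (χ = D4Irrep.E → d = 2) ∧ (χ ≠ D4Irrep.E → d = 1) := by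
    by_cases hE : χ = D4Irrep.E
    · exact ⟨2, by norm_num, by rw [if_pos hE]; norm_num, fun _ => rfl, fun h => absurd hE h⟩
    · exact ⟨1, le_rfl, by rw [if_neg hE]; norm_num, fun h => absurd h hE, fun _ => rfl⟩
  have hmult : ∀ (c' : ℝ) (v : V), c' < 0 → v ≠ 0 → T v = (c' : ℝ) • v →
      ∃ w : Fin d → V, Orthonormal ℝ w ∧ ∀ j, T (w j) = (c' : ℝ) • w j := by
    by_cases hE : χ = D4Irrep.E
    · rw [hdE hE]
      have hUV : ∀ v ∈ V, U₁ v ∈ V := by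
        intro v hv
        rw [hmemV] at hv ⊢
        have h1 := congrArg (fun f => f v) hPU
        simp only [mul_apply_eq_comp] at h1
        rw [hv] at h1
        exact h1
      have horth : ∀ v ∈ V, inner ℝ v (U₁ v) = 0 := fun v hv => hEskew hE v ((hmemV v).1 hv)
      exact doublet_of_isometry (𝕜 := ℝ) hT hAU hUV hUinner horth
    · rw [hdnE hE]
      intro c' v _ hv hTv
      have hvn : ‖(v : Lp ℝ 2 (fermiCurveMeasure ε μ))‖ ≠ 0 := by
        rw [Submodule.norm_coe]; exact norm_ne_zero_iff.2 hv
      refine ⟨![(‖(v : Lp ℝ 2 (fermiCurveMeasure ε μ))‖⁻¹ : ℝ) • v], ?_, ?_⟩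
      · rw [orthonormal_iff_ite]
        intro i j
        fin_cases i; fin_cases j
        simp only [Fin.zero_eta, Fin.isValue, Matrix.cons_val_fin_one, ↓reduceIte]
        rw [Submodule.coe_inner, Submodule.coe_smul, real_inner_smul_left, real_inner_smul_right,
          real_inner_self_eq_norm_sq]
        field_simp
      · intro j
        fin_cases j
        simp only [Fin.zero_eta, Fin.isValue, Matrix.cons_val_fin_one, map_smul, hTv]
        rw [smul_comm]
  -- negative square mass
  have hfam : ∀ (m : ℕ) (f : Fin m → Lp ℝ 2 (fermiCurveMeasure ε μ)), Orthonormal ℝ f →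
      (∀ j, f j ∈ V) →
      ∑ j, ‖A (f j) - (∑ m, c m • (innerSL ℝ ((hu m).toLp (u m))).smulRight ((hu m).toLp (u m))) (f j)‖ ^ 2 ≤ h :=
    fun m f hf hfV => (hHS m f hf fun j => (hmemV _).1 (hfV j)).trans hH
  have hsq := negSqMass_le_of_family_bound (𝕜 := ℝ) hT (fun y => by simpa using hBpos y) hfam
  -- Temple
  have hβ' : h - d * ρhi ^ 2 ≤ β ^ 2 := by rw [hdcast]; exact hβ
  obtain ⟨l, hl, hlρ, hLl, hray, hgap, hkato, hmass⟩ :=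
    temple_certificate (𝕜 := ℝ) hTc hTsa hd hmult hsq hxnorm (by simpa using hρlo') (by simpa using hρhi') hρhi0
      hTx hβ0 hβ' hρβ
  refine ⟨A, P, U₁, V, T, x, l, hmemV, hVc, hA, hAinner, hAsa, hAc, hAP, hPfix, hPrepr, hU₁ae, hAU, hPU, hUinner, hEskew, hT,
    hxnorm, hxdef, ?_, hlρ, hLl, fun y => by simpa using hray y, ?_, ?_, hmass⟩
  · obtain ⟨v, hv, hTv⟩ := hl
    exact ⟨v, hv, by simpa using hTv⟩
  · intro c' v hv hTv
    exact hgap c' v hv (by simpa using hTv)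
  · obtain ⟨v, hTv, hdist⟩ := hkato
    exact ⟨v, by simpa using hTv, hdist⟩

/-! ### The stub: bounds for the channel bottom -/

set_option maxHeartbeats 400000 in
/-- **Certified bounds for one channel bottom** (`stub_klChannelBound`): under the enclosure hypotheses of `kltp_cb_setup`,
`min ((βρlo - α)/(β - ρlo)) ((βρhi - α)/(β - ρhi)) ≤ channelInf ε₀ μ 1 χ`, and `channelInf ε₀ μ 1 χ ≤ ρhi` unless `χ = A1g`
without the bare-`U` term (Ritz with the normalised trial; Temple via `temple_certificate`; Rayleigh quotients of
`P`-fixed unit vectors are pairing forms of channel states). [cite: ReedSimonIV1978, Thm. XIII.5] -/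
theorem kltp_channelBound (ε : Momentum → ℝ) : ∀ μ : ℝ, KLTPAnalytic ε μ → ∀ (χ : D4Irrep) (withU : Bool) (M : ℕ) (c : Fin M → ℝ)
    (u : Fin M → Momentum → ℝ) (Φ : Momentum → ℝ) (ρlo ρhi α h β : ℝ),
    (withU = true → χ = D4Irrep.A1g) → (∀ m, 0 ≤ c m) →
    (∀ m, MemLp (u m) 2 (fermiCurveMeasure ε μ)) →
    MemLp Φ 2 (fermiCurveMeasure ε μ) → InChannel χ Φ →
    0 < ∫ k, Φ k ^ 2 ∂fermiCurveMeasure ε μ →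
    ρlo * ∫ k, Φ k ^ 2 ∂fermiCurveMeasure ε μ ≤
      ∫ k, Φ k * ∫ k', ((if withU then 1 else 0) + lindhardFunction ε μ (k + k')) * Φ k'
        ∂fermiCurveMeasure ε μ ∂fermiCurveMeasure ε μ →
    ∫ k, Φ k * ∫ k', ((if withU then 1 else 0) + lindhardFunction ε μ (k + k')) * Φ k'
        ∂fermiCurveMeasure ε μ ∂fermiCurveMeasure ε μ ≤
      ρhi * ∫ k, Φ k ^ 2 ∂fermiCurveMeasure ε μ →
    ρhi < 0 →
    ∫ k, (∫ k', ((if withU then 1 else 0) + lindhardFunction ε μ (k + k')) * Φ k'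
        ∂fermiCurveMeasure ε μ) ^ 2 ∂fermiCurveMeasure ε μ ≤
      α * ∫ k, Φ k ^ 2 ∂fermiCurveMeasure ε μ →
    ∫ z, (d4Project χ (fun q => (if withU then 1 else 0) + lindhardFunction ε μ (z.1 + q)) z.2 -
        ∑ m, c m * (u m z.1 * u m z.2)) ^ 2
        ∂(fermiCurveMeasure ε μ).prod (fermiCurveMeasure ε μ) ≤ h →
    β ≤ 0 → h - (if χ = D4Irrep.E then 2 else 1) * ρhi ^ 2 ≤ β ^ 2 → ρhi < β →
    min ((β * ρlo - α) / (β - ρlo)) ((β * ρhi - α) / (β - ρhi)) ≤ channelInf ε μ 1 χ ∧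
    ((withU = true ∨ χ ≠ D4Irrep.A1g) → channelInf ε μ 1 χ ≤ ρhi) := by
  intro μ hμ χ withU M c u Φ ρlo ρhi α h β hU hc hu hΦ hΦch hN hρlo hρhi hρhi0 hα hH hβ0 hβ hρβ
  -- a derived `MemLp` proof for each `u m` so that the operators of the setup are well defined
  obtain ⟨A, P, U₁, V, T, x, l, hmemV, -, hA, hAinner, -, -, -, hPfix, hPrepr, -, -, -, -, -, hT, hxnorm, hxdef, -, hlρ, hLl,
    hray, -, -, -⟩ := kltp_cb_setup hμ χ withU hU hu hc hΦ hΦch hN hρlo hρhi hρhi0 hα hH hβ0 hβ hρβ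
  -- every channel state has pairing form `≥ l`
  have hlow : ∀ ψ, IsChannelState ε μ χ ψ →
      l ≤ pairingForm ε μ 1 ψ := by
    intro ψ hψ
    have hvae : (hψ.1.toLp ψ : Momentum → ℝ) =ᵐ[fermiCurveMeasure ε μ] ψ := hψ.1.coeFn_toLp
    have hvV : P (hψ.1.toLp ψ) = hψ.1.toLp ψ := hPfix ψ hψ.1 hψ.2.2
    have hvnorm : ‖hψ.1.toLp ψ‖ = 1 := by
      have h2 : ‖hψ.1.toLp ψ‖ ^ 2 = 1 := by rw [kl_bs_norm_sq_eq_integral_of_ae_eq hvae, hψ.2.1]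
      exact (pow_eq_one_iff_of_nonneg (norm_nonneg _) two_ne_zero).1 h2
    have h1 := hray ⟨hψ.1.toLp ψ, (hmemV _).2 hvV⟩
    rw [(compression_inner_norm hT _).1] at h1
    change l * ‖hψ.1.toLp ψ‖ ^ 2 ≤ inner ℝ (hψ.1.toLp ψ) (A (hψ.1.toLp ψ)) at h1
    rw [hvnorm, one_pow, mul_one, kl_bs_inner_eq_of_ae_eq
      (fun q => (if withU then 1 else 0) + lindhardFunction ε μ q) A hAinner hvae] at h1
    exact h1.trans (kltp_cb_pairingForm_ge hμ hU hψ).1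
  have hne : ((pairingForm ε μ 1) '' {ψ | IsChannelState ε μ χ ψ}).Nonempty :=
    (hμ.2.2.2.2 χ).image _
  have hbdd : BddBelow ((pairingForm ε μ 1) '' {ψ | IsChannelState ε μ χ ψ}) :=
    ⟨l, by rintro r ⟨ψ, hψ, rfl⟩; exact hlow ψ hψ⟩
  refine ⟨hLl.trans (le_csInf hne (by rintro r ⟨ψ, hψ, rfl⟩; exact hlow ψ hψ)), fun hcase => ?_⟩
  -- the upper bound from the representative of the trial vector
  have hxfix : P (x : Lp ℝ 2 (fermiCurveMeasure ε μ)) = x := (hmemV _).1 x.2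
  obtain ⟨ψ, hch, hmem, hae⟩ := hPrepr _ hxfix
  have hnorm1 : ‖(x : Lp ℝ 2 (fermiCurveMeasure ε μ))‖ = 1 := hxnorm
  have hstate : IsChannelState ε μ χ ψ :=
    ⟨hmem, by rw [← kl_bs_norm_sq_eq_integral_of_ae_eq hae, hnorm1, one_pow], hch⟩
  have hval : pairingForm ε μ 1 ψ = inner ℝ x (T x) := by
    rw [(kltp_cb_pairingForm_ge hμ hU hstate).2 hcase, (compression_inner_norm hT x).1,
      kl_bs_inner_eq_of_ae_eq (fun q => (if withU then 1 else 0) + lindhardFunction ε μ q) A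
        hAinner hae]
  have hρx : inner ℝ x (T x) ≤ ρhi := by
    -- `inner x (T x) = Q/N ≤ ρhi`: recomputed from the explicit form of `x`
    have hinner₀ := kl_bs_inner_eq_of_ae_eq (fun q => (if withU then 1 else 0) + lindhardFunction ε μ q)
      A hAinner (hΦ.coeFn_toLp)
    have hsqrtN : 0 < Real.sqrt (∫ k, Φ k ^ 2 ∂fermiCurveMeasure ε μ) := Real.sqrt_pos.2 hN
    rw [(compression_inner_norm hT x).1, hxdef, map_smul, real_inner_smul_left, real_inner_smul_right, ← mul_assoc,
      ← mul_inv, Real.mul_self_sqrt hN.le, hinner₀, inv_mul_le_iff₀ hN]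
    linarith
  calc channelInf ε μ 1 χ ≤ pairingForm ε μ 1 ψ :=
        csInf_le hbdd ⟨ψ, hstate, rfl⟩
    _ ≤ ρhi := hval ▸ hρx

/-! ## ChannelFar, generic -/

/-- generic `stub_klChannelFar`. [folklore] -/
theorem kltp_channelFar (ε : Momentum → ℝ) : ∀ μ : ℝ, KLTPAnalytic ε μ → ∀ (χ : D4Irrep) (withU : Bool) (M : ℕ) (c : Fin M → ℝ)
    (u : Fin M → Momentum → ℝ) (h s : ℝ),
    (withU = true → χ = D4Irrep.A1g) → (∀ m, 0 ≤ c m) →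
    (∀ m, MemLp (u m) 2 (fermiCurveMeasure ε μ)) →
    ∫ z, (d4Project χ (fun q => (if withU then 1 else 0) + lindhardFunction ε μ (z.1 + q)) z.2 -
        ∑ m, c m * (u m z.1 * u m z.2)) ^ 2
        ∂(fermiCurveMeasure ε μ).prod (fermiCurveMeasure ε μ) ≤ h →
    0 ≤ s → h ≤ s ^ 2 →
    -s ≤ channelInf ε μ 1 χ := by
  intro μ hμ χ withU M c u h s hU hc hu hH hs hhs
  haveI : IsFiniteMeasure (fermiCurveMeasure ε μ) := hμ.1
  obtain ⟨A, P, U₁, hA, hAinner, hAsa, hAc, hAP, -, -, -, hPfix, hPrepr, -, -, -, -, -, hHS, hBpos⟩ :=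
    @kltp_channelOps ε μ hμ.1 hμ.2.1 hμ.2.2.1 hμ.2.2.2.1 χ withU M c u hu hU hc
  obtain ⟨V, hmemV, hVc⟩ : ∃ V : Submodule ℝ (Lp ℝ 2 (fermiCurveMeasure ε μ)),
      (∀ v, v ∈ V ↔ P v = v) ∧ CompleteSpace V :=
    ⟨_, fun v => kl_cb_mem_ker_iff P v, (ContinuousLinearMap.isClosed_ker _).completeSpace_coe⟩
  haveI : CompleteSpace V := hVc
  have hVA : ∀ v ∈ V, A v ∈ V := by
    intro v hv
    rw [hmemV] at hv ⊢
    have h1 := congrArg (fun f => f v) hAP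
    simp only [mul_apply_eq_comp] at h1
    rw [hv] at h1
    exact h1.symm
  obtain ⟨T, hT, hTsa', hTc'⟩ := exists_compression A V hVA
  have hfam : ∀ (m : ℕ) (f : Fin m → Lp ℝ 2 (fermiCurveMeasure ε μ)), Orthonormal ℝ f →
      (∀ j, f j ∈ V) →
      ∑ j, ‖A (f j) - (∑ m, c m • (innerSL ℝ ((hu m).toLp (u m))).smulRight ((hu m).toLp (u m))) (f j)‖ ^ 2 ≤ h :=
    fun m f hf hfV => (hHS m f hf fun j => (hmemV _).1 (hfV j)).trans hH
  have hsq := negSqMass_le_of_family_bound (𝕜 := ℝ) hT (fun y => by simpa using hBpos y) hfam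
  have hray : ∀ y : V, -s * ‖y‖ ^ 2 ≤ inner ℝ y (T y) := fun y => by
    simpa using rayleigh_ge_neg_of_negSqMass_le (𝕜 := ℝ) (hTc' hAc) (hTsa' hAsa) hs hhs hsq y
  -- dictionary: every channel state has pairing form `≥ -s`
  have hlow : ∀ ψ, IsChannelState ε μ χ ψ → -s ≤ pairingForm ε μ 1 ψ := by
    intro ψ hψ
    have hvae : (hψ.1.toLp ψ : Momentum → ℝ) =ᵐ[fermiCurveMeasure ε μ] ψ := hψ.1.coeFn_toLp
    have hvV : P (hψ.1.toLp ψ) = hψ.1.toLp ψ := hPfix ψ hψ.1 hψ.2.2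
    have hvnorm : ‖hψ.1.toLp ψ‖ = 1 := by
      have h2 : ‖hψ.1.toLp ψ‖ ^ 2 = 1 := by rw [kl_bs_norm_sq_eq_integral_of_ae_eq hvae, hψ.2.1]
      exact (pow_eq_one_iff_of_nonneg (norm_nonneg _) two_ne_zero).1 h2
    have h1 := hray ⟨hψ.1.toLp ψ, (hmemV _).2 hvV⟩
    rw [(compression_inner_norm hT _).1] at h1
    change -s * ‖hψ.1.toLp ψ‖ ^ 2 ≤ inner ℝ (hψ.1.toLp ψ) (A (hψ.1.toLp ψ)) at h1
    rw [hvnorm, one_pow, mul_one, kl_bs_inner_eq_of_ae_eq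
      (fun q => (if withU then 1 else 0) + lindhardFunction ε μ q) A hAinner hvae] at h1
    exact h1.trans (kltp_cb_pairingForm_ge hμ hU hψ).1
  have hne : ((pairingForm ε μ 1) '' {ψ | IsChannelState ε μ χ ψ}).Nonempty :=
    (hμ.2.2.2.2 χ).image _
  exact le_csInf hne (by rintro r ⟨ψ, hψ, rfl⟩; exact hlow ψ hψ)


end Summit.HubbardSuperconductivity.HubbardSuperconductivity.Theorems

end
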